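/-
Copyright (c) 2026 the pub-hodgecm-mathlib formalisation cell (harness21).  Prover seat hodgecm-mathlib-K2E5-p17 (g4), Track B «K2-LIT» ∕ h413
(`stmt-HodgeConjecture-24833`), line `K2_E3_EllipticInputs`, unit U12 «Characters», road «GL-[M6]-sc» (line lead K2E3-p23 (g5), MEMO «M6sc-ROAD v2» §2,
RULINGS #9 (M9-1) 2026-09-04T06:38Z), brick B4-A1: «CUSP-FORM CANCELLATION ALONG THE HEISENBERG UNIPOTENT RADICAL `N = N_B` OF THE BOREL OF `GL₃(F)` AT A
REGULAR ELEMENT OF THE (2,1)-LEVI» (the (T_A) twin of B4-E1; Harish-Chandra's Theorem 20 substitution for the split torus).  2026-09-04.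
-/
import Summits.HodgeConjecture.HodgeConjecture.Theorems.K2E3GL3CuspFormCancellationMaxParabolic   -- ★ B4-E1 (this seat): `integral_unipotentRadical21_conj_eq_zero_of_cuspForm`
import Literature.NumberTheory.Automorphic.GL3UpperUnipotentTwistedConjugation                    -- ★ `exists_homeomorph_rootGroup_fin_three`, `isClosed_unipotentRadicalGL`, `unipotentRadicalGL_comp_le`, …
import Literature.NumberTheory.Automorphic.GLnParabolicIntermediateHaar                           -- ★ `exists_haar_eq_smul_map_mul` (`μ_N = κ₀ • (v,u ↦ v u)_*(α ⊗ μ_U)`)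
import Literature.NumberTheory.Automorphic.GLnMaximalParabolicLocalModulus                        -- ★ `isHaarMeasure_map_of_map_add`
import HarnessLib

/-!
# K2_E3 road (h413), U12 «Characters», brick B4-A1: cusp-form cancellation along the Heisenberg radical `N_B ≤ GL₃(F)`

Cell `pub/hodgecm-mathlib` (D-0151), Track B, seat K2E5-p17 (g4) (free E5 hand serving the E3 road «GL-[M6]-sc» by name); line lead K2E3-p23 (g5), dealer
K2E3-plan (g3).  `--supports stmt-HodgeConjecture-24833 --as helper`; THEOREMS ONLY (no definition ∕ instance ∕ notation ∕ named fact ∕ `sorry`); never imports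
`Cruxes/…/Lines`.  COUNT-NEUTRAL.  Consumer: B4-A2 `K2E3GL3TruncatedCharSplitTorus` (the non-elliptic estimates for the split torus `A`); the cusp hypothesis
along `N_{(2,1)}` is B4-J's (K2E3-p21 (g5)) in the shape «`∀ x y, ∫ u : ↥N_{(2,1)}, θ̃ (x * u * y) ∂ν = 0`».

THE MATHEMATICS [HarishChandra1970, Part VII §2 (proof of Thm. 20), §8 Lemma 57; Rogawski1990, §4.13, proof of Lemma 4.13.1 p. 70].  `N = N_B` (upper
unitriangular, `U_{id}`) is the semidirect product `N = V ⋉ U` of the root group `V = N ∩ M_{(2,1)} ≅ F` and the ABELIAN radical `U = N_{(2,1)} ≅ F²`, and every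
Haar measure of `N` is `κ₀ · (v,u ↦ v u)_*(α ⊗ μ_U)` (★ `exists_haar_eq_smul_map_mul`).  For `t ∈ M_{(2,1)} = GL₂ × GL₁` with `χ_A(t₂₂) ≠ 0` (`t = diag(A, λ)`;
for the split torus: `t = diag(t₀,t₁,t₂)` with `t₂ ∉ {t₀, t₁}` — NO condition `t₀ ≠ t₁` is needed) and `θ` a cusp form along `U`:
  `∫_N θ(x · n t n⁻¹ · y) dn = κ₀ ∫_V ∫_U θ((x v) · u t u⁻¹ · (v⁻¹ y)) du dv = κ₀ ∫_V 0 dv = 0`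
by ★ B4-E1 `integral_unipotentRadical21_conj_eq_zero_of_cuspForm` in the inner integral (and `∫ = 0` by convention if the integrand is not integrable on
`V × U`, so no integrability hypothesis is needed).  Only ONE step of the root filtration is used: the substitution on the root group `V` (Jacobian `1 − t₀∕t₁`,
★ `lintegral_upperUnitriangular_three_conj_diagonal_eq_mul`) is NOT needed for the vanishing.
* **`integral_upperUnitriangular_conj_eq_zero_of_cuspForm`** — `t ∈ M_{(2,1)}`, `χ_A(t₂₂) ≠ 0`, cusp along `N_{(2,1)}` ⇒ `∫_{N_B} θ(x · n t n⁻¹ · y) dn = 0`.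
* **`integral_upperUnitriangular_conj_glDiagonal_eq_zero_of_cuspForm`** — the split-torus reading `t = diag(t₀,t₁,t₂)`, `t₀ ≠ t₂`, `t₁ ≠ t₂`.

HONEST LABEL: HC_CM is proved only modulo the 7 printed citations (2 remaining named inputs: hLiu418 = stmt-HodgeConjecture-24832, h413 = stmt-HodgeConjecture-24833)
until rung 0 closes; count-neutral helper.
-/

set_option autoImplicit false
set_option linter.dupNamespace false   -- `Summit.HodgeConjecture.HodgeConjecture.…` (D-0017 nested layout; lakefile exemption for Summits)

noncomputable section

open MeasureTheory MeasureTheory.Measure Matrix Topology Polynomial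
open scoped MatrixGroups NNReal ENNReal
open Literature.NumberTheory.Automorphic
open Literature.NumberTheory.GaloisRepresentations Literature.NumberTheory.GaloisRepresentations.IsNonarchimedeanLocalField
open Summit.HodgeConjecture.HodgeConjecture.Cruxes.H413.K2E3GL3CuspFormCancellationMaxParabolic

namespace Summit.HodgeConjecture.HodgeConjecture.Cruxes.H413.K2E3GL3CuspFormCancellationBorel

variable {F : Type*} [Field F] [ValuativeRel F] [TopologicalSpace F] [IsNonarchimedeanLocalField F] [MeasurableSpace F] [BorelSpace F]
  [MeasurableSpace (GL (Fin 3) F)] [BorelSpace (GL (Fin 3) F)]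
  {E : Type*} [NormedAddCommGroup E] [NormedSpace ℝ E]

/-- **B4-A1 — cusp-form cancellation along the Heisenberg radical `N_B` of `GL₃(F)`.**  For `t ∈ M_{(2,1)} = GL₂ × GL₁` with `χ_A(t₂₂) ≠ 0` (`t = diag(A, t₂₂)`),
every Haar measure `ν_N` on `N_B = U_{id}`, every Haar measure `ν_U` on `N_{(2,1)}`, every `θ : GL₃(F) → E` which is a cusp form along `N_{(2,1)}`
(`∫ θ(x u y) dν_U(u) = 0` for all `x, y`) and all `x, y`: **`∫_{N_B} θ(x · n t n⁻¹ · y) dν_N(n) = 0`**.  (`N_B = V ⋉ N_{(2,1)}`, ★ `exists_haar_eq_smul_map_mul`;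
Fubini; ★ B4-E1 in the inner integral — or `∫ = 0` for a non-integrable integrand.) [cite: HarishChandra1970, Part VII §2, §8 Lemma 57]
[cite: Rogawski1990, §4.13, proof of Lemma 4.13.1, p. 70] -/
theorem integral_upperUnitriangular_conj_eq_zero_of_cuspForm
    (νN : Measure ↥(unipotentRadicalGL F (id : Fin 3 → Fin 3))) [IsHaarMeasure νN]
    (νU : Measure ↥(unipotentRadicalGL F (![false, false, true] : Fin 3 → Bool))) [IsHaarMeasure νU]
    {t : GL (Fin 3) F} (ht : t ∈ standardLeviGL F (![false, false, true] : Fin 3 → Bool))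
    (hreg : (!![(t : Matrix (Fin 3) (Fin 3) F) 0 0, (t : Matrix (Fin 3) (Fin 3) F) 0 1;
              (t : Matrix (Fin 3) (Fin 3) F) 1 0, (t : Matrix (Fin 3) (Fin 3) F) 1 1] : Matrix (Fin 2) (Fin 2) F).charpoly.eval
            ((t : Matrix (Fin 3) (Fin 3) F) 2 2) ≠ 0)
    (θ : GL (Fin 3) F → E)
    (hcusp : ∀ x y : GL (Fin 3) F, ∫ u : ↥(unipotentRadicalGL F (![false, false, true] : Fin 3 → Bool)), θ (x * (u : GL (Fin 3) F) * y) ∂νU = 0)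
    (x y : GL (Fin 3) F) :
    ∫ n : ↥(unipotentRadicalGL F (id : Fin 3 → Fin 3)), θ (x * ((n : GL (Fin 3) F) * t * ((n : GL (Fin 3) F))⁻¹) * y) ∂νN = 0 := by
  classical
  haveI : T2Space F := (isLocalField F).toT2Space
  haveI : SecondCountableTopology F := secondCountableTopology_localField F
  haveI : LocallyCompactSpace F := (isLocalField F).toLocallyCompactSpace
  haveI : IsTopologicalRing F := inferInstance
  haveI : SecondCountableTopology (Matrix (Fin 3) (Fin 3) F) := inferInstanceAs (SecondCountableTopology (Fin 3 → Fin 3 → F))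
  haveI : SecondCountableTopology (Matrix (Fin 3) (Fin 3) F)ᵐᵒᵖ := MulOpposite.opHomeomorph.symm.secondCountableTopology
  haveI : SecondCountableTopology (GL (Fin 3) F) := Units.isEmbedding_embedProduct.secondCountableTopology
  haveI : LocallyCompactSpace (Matrix (Fin 3) (Fin 3) F) := inferInstanceAs (LocallyCompactSpace (Fin 3 → Fin 3 → F))
  haveI : LocallyCompactSpace (GL (Fin 3) F) := inferInstance
  -- `N_{(2,1)} ≤ N_B ≤ P_{(2,1)}`, `N_B` closed
  have hmono : Monotone (![false, false, true] : Fin 3 → Bool) := by decide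
  have hUN : unipotentRadicalGL F (![false, false, true] : Fin 3 → Bool) ≤ unipotentRadicalGL F (id : Fin 3 → Fin 3) :=
    unipotentRadicalGL_comp_le (R := F) (id : Fin 3 → Fin 3) hmono
  have hNP : unipotentRadicalGL F (id : Fin 3 → Fin 3) ≤ standardParabolicGL F (![false, false, true] : Fin 3 → Bool) :=
    unipotentRadicalGL_le_standardParabolicGL_comp (R := F) (id : Fin 3 → Fin 3) hmono
  have hNc : IsClosed ((unipotentRadicalGL F (id : Fin 3 → Fin 3) : Subgroup (GL (Fin 3) F)) : Set (GL (Fin 3) F)) :=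
    isClosed_unipotentRadicalGL (id : Fin 3 → Fin 3)
  haveI : SecondCountableTopology ↥(unipotentRadicalGL F (![false, false, true] : Fin 3 → Bool)) := TopologicalSpace.Subtype.secondCountableTopology _
  haveI : BorelSpace ↥(unipotentRadicalGL F (![false, false, true] : Fin 3 → Bool)) := Subtype.borelSpace _
  haveI : LocallyCompactSpace ↥(unipotentRadicalGL F (![false, false, true] : Fin 3 → Bool)) :=
    (isClosed_unipotentRadicalGL (![false, false, true] : Fin 3 → Bool)).locallyCompactSpace
  haveI : BorelSpace ↥(unipotentRadicalGL F (id : Fin 3 → Fin 3) ⊓ standardLeviGL F (![false, false, true] : Fin 3 → Bool)) := Subtype.borelSpace _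
  haveI : SecondCountableTopology ↥(unipotentRadicalGL F (id : Fin 3 → Fin 3) ⊓ standardLeviGL F (![false, false, true] : Fin 3 → Bool)) :=
    TopologicalSpace.Subtype.secondCountableTopology _
  -- a Haar measure on the root group `V = N_B ∩ M_{(2,1)} ≅ (F, +)`
  obtain ⟨w, -, hwadd⟩ := exists_homeomorph_rootGroup_fin_three F
  set αV : Measure ↥(unipotentRadicalGL F (id : Fin 3 → Fin 3) ⊓ standardLeviGL F (![false, false, true] : Fin 3 → Bool)) :=
    Measure.map w (Measure.addHaar : Measure F) with hαV
  haveI : IsHaarMeasure αV := isHaarMeasure_map_of_map_add w hwadd _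
  haveI : SFinite αV := inferInstance
  haveI : SFinite νU := inferInstance
  -- `ν_N = κ₀ • (v,u ↦ v u)_* (α_V ⊗ ν_U)`
  obtain ⟨e, κ₀, -, -, he, hνN⟩ := exists_haar_eq_smul_map_mul F hNc hUN hNP νN αV νU
  rw [hνN, integral_smul_measure, ← show (e.toMeasurableEquiv : _ → ↥(unipotentRadicalGL F (id : Fin 3 → Fin 3))) = e from e.toMeasurableEquiv_coe,
    integral_map_equiv]
  simp only [Homeomorph.toMeasurableEquiv_coe]
  -- the integrand on `V × U`, re-bracketed: `x · (v u) t (v u)⁻¹ · y = (x v) · (u t u⁻¹) · (v⁻¹ y)`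
  have hrw : ∀ q : ↥(unipotentRadicalGL F (id : Fin 3 → Fin 3) ⊓ standardLeviGL F (![false, false, true] : Fin 3 → Bool)) ×
      ↥(unipotentRadicalGL F (![false, false, true] : Fin 3 → Bool)),
      x * (((e q : ↥(unipotentRadicalGL F (id : Fin 3 → Fin 3))) : GL (Fin 3) F) * t * (((e q : ↥(unipotentRadicalGL F (id : Fin 3 → Fin 3))) : GL (Fin 3) F))⁻¹) * y =
        x * (q.1 : GL (Fin 3) F) * ((q.2 : GL (Fin 3) F) * t * ((q.2 : GL (Fin 3) F))⁻¹) * (((q.1 : GL (Fin 3) F))⁻¹ * y) := fun q => by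
    simp only [he q, _root_.mul_inv_rev, mul_assoc]
  simp_rw [hrw]
  by_cases hint : Integrable (fun q : ↥(unipotentRadicalGL F (id : Fin 3 → Fin 3) ⊓ standardLeviGL F (![false, false, true] : Fin 3 → Bool)) ×
      ↥(unipotentRadicalGL F (![false, false, true] : Fin 3 → Bool)) =>
      θ (x * (q.1 : GL (Fin 3) F) * ((q.2 : GL (Fin 3) F) * t * ((q.2 : GL (Fin 3) F))⁻¹) * (((q.1 : GL (Fin 3) F))⁻¹ * y))) (αV.prod νU)
  · rw [integral_prod _ hint]
    have hinner : ∀ v : ↥(unipotentRadicalGL F (id : Fin 3 → Fin 3) ⊓ standardLeviGL F (![false, false, true] : Fin 3 → Bool)),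
        ∫ u : ↥(unipotentRadicalGL F (![false, false, true] : Fin 3 → Bool)),
          θ (x * (v : GL (Fin 3) F) * ((u : GL (Fin 3) F) * t * ((u : GL (Fin 3) F))⁻¹) * (((v : GL (Fin 3) F))⁻¹ * y)) ∂νU = 0 := fun v =>
      integral_unipotentRadical21_conj_eq_zero_of_cuspForm νU ht hreg θ hcusp (x * (v : GL (Fin 3) F)) (((v : GL (Fin 3) F))⁻¹ * y)
    simp_rw [hinner]
    rw [integral_zero, smul_zero]
  · rw [integral_undef hint, smul_zero]

omit [ValuativeRel F] [TopologicalSpace F] [IsNonarchimedeanLocalField F] [MeasurableSpace F] [BorelSpace F] [MeasurableSpace (GL (Fin 3) F)]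
  [BorelSpace (GL (Fin 3) F)] in
/-- The characteristic polynomial of a diagonal `2 × 2` block at `λ`: `χ_{diag(t₀,t₁)}(λ) = (λ − t₀)(λ − t₁)`; regularity of `diag(t₀,t₁,t₂)` for the box `𝔲_{(2,1)}`
is `t₂ ∉ {t₀, t₁}`. [folklore] -/
theorem eval_charpoly_glDiagonal_topLeft (d : Fin 3 → Fˣ) :
    (!![((glDiagonal 3 F d : GL (Fin 3) F) : Matrix (Fin 3) (Fin 3) F) 0 0, ((glDiagonal 3 F d : GL (Fin 3) F) : Matrix (Fin 3) (Fin 3) F) 0 1;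
        ((glDiagonal 3 F d : GL (Fin 3) F) : Matrix (Fin 3) (Fin 3) F) 1 0, ((glDiagonal 3 F d : GL (Fin 3) F) : Matrix (Fin 3) (Fin 3) F) 1 1] :
        Matrix (Fin 2) (Fin 2) F).charpoly.eval (((glDiagonal 3 F d : GL (Fin 3) F) : Matrix (Fin 3) (Fin 3) F) 2 2) =
      ((d 2 : F) - d 0) * ((d 2 : F) - d 1) := by
  rw [eval_charpoly_fin_two]
  simp [coe_glDiagonal, Matrix.diagonal_apply_eq, Matrix.diagonal_apply_ne]

omit [ValuativeRel F] [TopologicalSpace F] [IsNonarchimedeanLocalField F] [MeasurableSpace F] [BorelSpace F] [MeasurableSpace (GL (Fin 3) F)]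
  [BorelSpace (GL (Fin 3) F)] in
/-- A diagonal matrix lies in the (2,1)-Levi. [folklore] -/
theorem glDiagonal_mem_standardLeviGL21 (d : Fin 3 → Fˣ) :
    glDiagonal 3 F d ∈ standardLeviGL F (![false, false, true] : Fin 3 → Bool) := by
  rw [mem_standardLeviGL_iff]
  intro i j hij
  rw [coe_glDiagonal, Matrix.diagonal_apply_ne]
  rintro rfl
  exact hij rfl

/-- **B4-A1, split-torus reading**: for `t = diag(t₀, t₁, t₂)` with `t₀ ≠ t₂`, `t₁ ≠ t₂` (no condition on `t₀, t₁`) and `θ` a cusp form along `N_{(2,1)}`: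
**`∫_{N_B} θ(x · n t n⁻¹ · y) dν_N(n) = 0`** for every Haar measure `ν_N` on the upper unitriangular group `N_B ≤ GL₃(F)` and all `x, y`.
[cite: HarishChandra1970, Part VII §2, §8 Lemma 57] [cite: Rogawski1990, §4.13, proof of Lemma 4.13.1, p. 70] -/
theorem integral_upperUnitriangular_conj_glDiagonal_eq_zero_of_cuspForm
    (νN : Measure ↥(unipotentRadicalGL F (id : Fin 3 → Fin 3))) [IsHaarMeasure νN]
    (νU : Measure ↥(unipotentRadicalGL F (![false, false, true] : Fin 3 → Bool))) [IsHaarMeasure νU]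
    (d : Fin 3 → Fˣ) (h02 : (d 0 : F) ≠ d 2) (h12 : (d 1 : F) ≠ d 2)
    (θ : GL (Fin 3) F → E)
    (hcusp : ∀ x y : GL (Fin 3) F, ∫ u : ↥(unipotentRadicalGL F (![false, false, true] : Fin 3 → Bool)), θ (x * (u : GL (Fin 3) F) * y) ∂νU = 0)
    (x y : GL (Fin 3) F) :
    ∫ n : ↥(unipotentRadicalGL F (id : Fin 3 → Fin 3)),
        θ (x * ((n : GL (Fin 3) F) * glDiagonal 3 F d * ((n : GL (Fin 3) F))⁻¹) * y) ∂νN = 0 := by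
  refine integral_upperUnitriangular_conj_eq_zero_of_cuspForm νN νU (glDiagonal_mem_standardLeviGL21 d) ?_ θ hcusp x y
  rw [eval_charpoly_glDiagonal_topLeft]
  exact mul_ne_zero (sub_ne_zero.2 h02.symm) (sub_ne_zero.2 h12.symm)

end Summit.HodgeConjecture.HodgeConjecture.Cruxes.H413.K2E3GL3CuspFormCancellationBorel
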